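import Mathlib.GroupTheory.ResiduallyFinite
import Literature.AnabelianGeometry.SemiGraphs.ArithOuterActionCongruenceOfCosetLevel
import Literature.AnabelianGeometry.SemiGraphs.ArithOuterActionStronglyCompleteCongruence
import Literature.AnabelianGeometry.SemiGraphs.ArithTowerLevelStabilityJunction
import HarnessLib

/-!
# [SemiAnbd] Def 5.1 (i)(c^new) / Prop 5.2 (i): TEMPERED congruence-continuity of the outer action AT THE TREE LEVELS of
# the chart of a cofinal Galois tower — the «T54-HCCT-PRODUCER» assembled (piece (P3-top); proof-only)

Mochizuki, *Semi-graphs of anabelioids*, Publ. RIMS **42** (2006) 221–322, §5: Def 5.1 (i) p. 62, Prop 5.2 (i) p. 63 and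
its proof p. 64 l. 67–74 («Assertions (i), (ii) follow from the various finiteness assumptions in our definition of a
"continuous action" …»), proof of Thm 3.7 (iii) p. 41 (the trees `𝒢_{∞,i}`), Thm 5.4 p. 66; [IUTchI] Rmk 2.5.3 (vi)
((c^new)/(d^new), (O3)). [cite: MochizukiSemiAnbd2006, Prop 5.2 (i), p. 63]

PROOF-ONLY file (abc-iut cell, layer L3, row «T54-HCCT-PRODUCER» of abc-iut-L3-lead δ7 (7) / δ23; seat abc-iut-w4-d085
gen 10; piece (P3-top) of `HOME/staging/w4/w4-d085/g10/SHAPES-T54-HCCT.md`).  No definition, no instance, no new named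
fact.  At the chart of a cofinal Galois tower `D` with characteristic finite levels (`hker : ker π_n = charOpenCore (d n)`,
abc-iut-L3-t9 / abc-iut-w4-d048) and ANY outer action `ρ : Π_A →* Out_top(π₁^temp(𝒢))` of a STRONGLY COMPLETE, COMPACT
`Π_A` with a base action on the finite graph `𝔾`, whose presentation `D.piPresentation T R` is `IsArithCompatible`
for `π₁^temp(𝒢) ⋊^out Π_A` (the T54 capstones' term, from the PRODUCED branch transport p460259):

* `GaloisLevelData.exists_nhds_forall_rep_congr_ker_projAut` — for every `n`, every `a` in some neighbourhood of
  `1` in `Π_A` has a representative of `ρ a` congruent to the identity MODULO THE TREE LEVEL `ker (D.projAut n)` —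
  the capstone binder `hCCt` of `ArithThm54CharCoresCapstoneV9` (p488210) at level `n` (its `(D.chart …).G` IS
  `D.temperedPi`, `GaloisLevelData.chart_G`), i.e. `hCCt` holds with `n₁ := 0` — FROM: strong completeness `hsc`
  (Def 5.1 (i)(a) + (O3)), compactness of `Π_A`, the coherence frame (finite `𝔾`), `hker` with UNBOUNDED `d`, and three
  displayed level inputs: `hrf` (the quotient by the tree level — `Gal(𝒢_{∞,n}/𝒢)` — is residually finite:
  abc-iut's `CovObj.residuallyFinite_aut_univCoverOver`, free-by-finite), `hH`/`hM` (the vertex / edge groups of the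
  presentation have FINITE image modulo the tree level: compact groups, open level), `hconnK` (the level-`ker projAut n`
  coset semi-graph is connected: it is the tree `𝔾_{𝒢_{∞,n}}`, `cosetGraphMapIso`).

Assembly: abc-iut-w4-d029's finite-level congruence `exists_nhds_forall_rep_congr_ker_piLevelAut` and
`exists_nhds_forall_baseAct_eq_one` (p457557) supply, at a deep finite level `M`, an OPEN (hence finite-index, `Π_A`
compact) subgroup `S₁` on which the base action is trivial and representatives are `≡ id (mod ker π_M)`; residual
finiteness + `hker` + unbounded `d` make `ker π_M · ker projAut n` avoid the finite exclusion set of this seat's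
`exists_nhds_forall_rep_congr_of_connected_cosetLevel` (p515385), whose stability inputs are abc-iut-w4-d089's
`hKst_and_hLst_of_ker_piLevelAut_eq_charOpenCore`; p515385 concludes.  HONEST LABEL: `hCCt` is thereby PRODUCED at the
chart modulo the three displayed level inputs `hrf` / `hH`,`hM` / `hconnK` (each a property of the tree levels of the
tempered tower, not of the arithmetic action); nothing here asserts a result of [SemiAnbd] for a genuine curve; no side
taken on [IUTchIII] Cor. 3.12; typed ≠ proved.
-/

namespace Literature.AnabelianGeometry.SemiGraphs

namespace ProfiniteSemiGraph

namespace GaloisLevelData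

open CategoryTheory Topology Filter Literature.AnabelianGeometry.EtaleTheta SemiGraph SemiGraph.SubgroupPresentation
open scoped Pointwise

universe u v

variable {𝒢 : ProfiniteSemiGraph.{u}}

/-- **TEMPERED congruence-continuity at the tree levels** (the capstone binder `hCCt`, [SemiAnbd] Def 5.1 (i)(c^new) /
Prop 5.2 (i), produced by print's finiteness argument): see the module docstring for the data and the residual
level inputs `hrf`, `hH`, `hM`, `hconnK`.  Conclusion: near `1` in `Π_A`, `ρ a` has a representative `φ` with
`φ(y)·y⁻¹ ∈ ker (D.projAut n)` for all `y`. [cite: MochizukiSemiAnbd2006, Prop 5.2 (i), p. 63] -/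
theorem exists_nhds_forall_rep_congr_ker_projAut (D : GaloisLevelData 𝒢) (h𝒢 : 𝒢.IsCountable)
    (hconn : ∀ (n : ℕ) (p q : (D.S n).Point), (D.S n).SameComponent p q) (hfin : ∀ n, (D.S n).IsFinite)
    (T : ∀ w : 𝒢.graph.Vertex, D.PointSeq h𝒢 w) (R : SemiGraph.RefBranches 𝒢.graph)
    {PA : Type v} [Group PA] [TopologicalSpace PA] [IsTopologicalGroup PA] [CompactSpace PA]
    (ρ : PA →* TopOut (D.temperedPi h𝒢)) (baseAct : PA →* Aut 𝒢.graph)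
    [Finite 𝒢.graph.Vertex] [Finite 𝒢.graph.Edge] [Finite 𝒢.graph.Branch]
    (hP : (D.piPresentation h𝒢 T R).IsArithCompatible
      (((contMulAut (D.temperedPi h𝒢)).subtype.comp (MonoidHom.fst (contMulAut (D.temperedPi h𝒢)) PA)).comp
        (outerSemidirectProduct ρ).subtype) (baseAct.comp (outerSemidirectProductSnd ρ)))
    (d : ℕ → ℕ) (hker : ∀ n, (D.piLevelAut h𝒢 hconn n).ker = charOpenCore (D.temperedPi h𝒢) (d n))
    (hd : ∀ N : ℕ, ∃ m, N ≤ d m)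
    (hsc : ∀ H : Subgroup PA, H.FiniteIndex → IsOpen (H : Set PA))
    (n : ℕ)
    (hrf : Group.ResiduallyFinite (D.temperedPi h𝒢 ⧸ (D.projAut h𝒢 n).ker))
    (hH : ∀ w : 𝒢.graph.Vertex, ((QuotientGroup.mk (s := (D.projAut h𝒢 n).ker)) ''
      ((D.piPresentation h𝒢 T R).H w : Set (D.temperedPi h𝒢))).Finite)
    (hM : ∀ ε : 𝒢.graph.Edge, ((QuotientGroup.mk (s := (D.projAut h𝒢 n).ker)) ''
      ((D.piPresentation h𝒢 T R).M ε : Set (D.temperedPi h𝒢))).Finite)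
    (hconnK : ((D.piPresentation h𝒢 T R).cosetGraph (D.projAut h𝒢 n).ker).IsConnected) :
    ∃ U ∈ 𝓝 (1 : PA), ∀ a ∈ U, ∃ φ : contMulAut (D.temperedPi h𝒢), TopOut.mk _ φ = ρ a ∧
      ∀ y : D.temperedPi h𝒢, (φ : MulAut (D.temperedPi h𝒢)) y * y⁻¹ ∈ (D.projAut h𝒢 n).ker := by
  classical
  -- stability of the tree level and of the finite levels under the arithmetic group (abc-iut-w4-d089)
  obtain ⟨hKst, hLst⟩ := D.hKst_and_hLst_of_ker_piLevelAut_eq_charOpenCore h𝒢 hconn T R ρ hP d hker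
  -- the core (p515385)
  obtain ⟨E₀, hE₀fin, hE₀K, hcore⟩ := exists_nhds_forall_rep_congr_of_connected_cosetLevel ρ hsc baseAct
    (D.piPresentation h𝒢 T R) hP (D.projAut h𝒢 n).ker (fun e x hx => hKst n e x hx) hH hM hconnK
  -- separation: each `g ∈ E₀` is excluded by some finite level `ker π_m · (D.projAut h𝒢 n).ker`
  have hsep : ∀ g ∈ E₀, ∃ m : ℕ, g ∉ (D.piLevelAut h𝒢 hconn m).ker ⊔ (D.projAut h𝒢 n).ker := by
    intro g hg
    haveI := hrf
    have hg1 : (QuotientGroup.mk g : D.temperedPi h𝒢 ⧸ (D.projAut h𝒢 n).ker) ≠ 1 := by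
      rw [Ne, QuotientGroup.eq_one_iff]; exact hE₀K g hg
    obtain ⟨N', hN'⟩ := Group.exists_finiteIndexNormalSubgroup_notMem _ hg1
    let N : Subgroup (D.temperedPi h𝒢) := N'.toSubgroup.comap (QuotientGroup.mk' (D.projAut h𝒢 n).ker)
    haveI : N.FiniteIndex := ⟨fun h0 => Subgroup.FiniteIndex.index_ne_zero (H := N'.toSubgroup)
      ((Subgroup.index_comap_of_surjective (H := N'.toSubgroup)
        (QuotientGroup.mk'_surjective (D.projAut h𝒢 n).ker)).symm.trans h0)⟩
    have hKN : (D.projAut h𝒢 n).ker ≤ N := fun x hx => by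
      change QuotientGroup.mk' (D.projAut h𝒢 n).ker x ∈ N'.toSubgroup
      rw [QuotientGroup.mk'_apply, (QuotientGroup.eq_one_iff x).mpr hx]
      exact one_mem _
    have hNopen : IsOpen (N : Set (D.temperedPi h𝒢)) := Subgroup.isOpen_mono hKN (D.isOpen_ker_projAut h𝒢 n)
    obtain ⟨m, hm⟩ := hd N.index
    refine ⟨m, fun hgm => hN' ?_⟩
    have hle : (D.piLevelAut h𝒢 hconn m).ker ⊔ (D.projAut h𝒢 n).ker ≤ N := by
      refine sup_le ?_ hKN
      rw [hker m]
      exact (charOpenCore_anti hm).trans (charOpenCore_le_of_finiteIndex N hNopen)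
    exact hle hgm
  choose! mOf hmOf using hsep
  -- one deep level below all of them
  let M : ℕ := hE₀fin.toFinset.sup mOf
  set L : Subgroup (D.temperedPi h𝒢) := (D.piLevelAut h𝒢 hconn M).ker ⊔ (D.projAut h𝒢 n).ker with hLdef
  have hKL : (D.projAut h𝒢 n).ker ≤ L := le_sup_right
  have hLE : ∀ g ∈ E₀, g ∉ L := by
    intro g hg hgL
    have hmM : mOf g ≤ M := Finset.le_sup (hE₀fin.mem_toFinset.mpr hg)
    exact hmOf g hg (sup_le_sup_right (D.ker_piLevelAut_anti h𝒢 hconn hmM) (D.projAut h𝒢 n).ker hgL)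
  haveI : Finite (D.temperedPi h𝒢 ⧸ (D.piLevelAut h𝒢 hconn M).ker) := D.finite_quotient_ker_piLevelAut h𝒢 hconn hfin M
  haveI : (D.piLevelAut h𝒢 hconn M).ker.FiniteIndex := Subgroup.finiteIndex_of_finite_quotient
  have hLfi : L.FiniteIndex := Subgroup.finiteIndex_of_le (le_sup_left : (D.piLevelAut h𝒢 hconn M).ker ≤ L)
  have hLst' : ∀ (e : outerSemidirectProduct ρ) (x : D.temperedPi h𝒢), x ∈ L →
      ((e.1.1 : MulAut (D.temperedPi h𝒢))) x ∈ L := by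
    intro e x hx
    have hx' : x ∈ ((D.piLevelAut h𝒢 hconn M).ker : Set (D.temperedPi h𝒢)) * ((D.projAut h𝒢 n).ker : Set (D.temperedPi h𝒢)) := by
      rw [← Subgroup.normal_mul]; exact hx
    obtain ⟨y, hy, z, hz, rfl⟩ := Set.mem_mul.mp hx'
    rw [map_mul]
    exact Subgroup.mul_mem_sup (hLst M e y hy) (hKst n e z hz)
  -- the open subgroup `S₁` from the finite-level congruence (abc-iut-w4-d029) and the trivial base action
  obtain ⟨U₁, hU₁, h₁⟩ := D.exists_nhds_forall_rep_congr_ker_piLevelAut h𝒢 hconn hfin d hker ρ hsc M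
  obtain ⟨U₂, hU₂, h₂⟩ := ProfiniteSemiGraph.exists_nhds_forall_baseAct_eq_one baseAct hsc
  let S₁ : Subgroup PA :=
    { carrier := {a | baseAct a = 1 ∧ ∃ φ : contMulAut (D.temperedPi h𝒢), TopOut.mk _ φ = ρ a ∧
        ∀ y : D.temperedPi h𝒢, (φ : MulAut (D.temperedPi h𝒢)) y * y⁻¹ ∈ L}
      one_mem' := ⟨map_one _, 1, by rw [map_one, map_one], fun y => by
        rw [show ((1 : contMulAut (D.temperedPi h𝒢)) : MulAut (D.temperedPi h𝒢)) y = y from rfl, mul_inv_cancel]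
        exact L.one_mem⟩
      mul_mem' := by
        rintro a b ⟨ha, φ, hφ, hφC⟩ ⟨hb, ψ, hψ, hψC⟩
        refine ⟨by rw [map_mul, ha, hb, mul_one], φ * ψ, by rw [map_mul, map_mul, hφ, hψ], fun y => ?_⟩
        have : ((φ * ψ : contMulAut (D.temperedPi h𝒢)) : MulAut (D.temperedPi h𝒢)) y * y⁻¹ =
            ((φ : MulAut _) ((ψ : MulAut _) y) * ((ψ : MulAut _) y)⁻¹) * ((ψ : MulAut _) y * y⁻¹) := by
          rw [Subgroup.coe_mul, MulAut.mul_apply]; group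
        rw [this]
        exact L.mul_mem (hφC _) (hψC y)
      inv_mem' := by
        rintro a ⟨ha, φ, hφ, hφC⟩
        refine ⟨by rw [map_inv, ha, inv_one], φ⁻¹, by rw [map_inv, map_inv, hφ], fun y => ?_⟩
        set w : D.temperedPi h𝒢 := ((φ⁻¹ : contMulAut (D.temperedPi h𝒢)) : MulAut (D.temperedPi h𝒢)) y with hw
        have hy : (φ : MulAut (D.temperedPi h𝒢)) w = y := by
          rw [hw, InvMemClass.coe_inv, ← MulAut.mul_apply, mul_inv_cancel]; rfl
        have : w * y⁻¹ = ((φ : MulAut (D.temperedPi h𝒢)) w * w⁻¹)⁻¹ := by rw [hy]; group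
        rw [this]
        exact L.inv_mem (hφC w) }
  have hS₁nhds : (S₁ : Set PA) ∈ 𝓝 (1 : PA) := by
    refine Filter.mem_of_superset (Filter.inter_mem hU₁ hU₂) fun a ha => ?_
    obtain ⟨φ, hφ, hφC⟩ := h₁ a ha.1
    exact ⟨h₂ a ha.2, φ, hφ, fun y => Subgroup.mem_sup_left (hφC y)⟩
  have hS₁open : IsOpen (S₁ : Set PA) := Subgroup.isOpen_of_mem_nhds S₁ hS₁nhds
  haveI : Finite (PA ⧸ S₁) := Subgroup.quotient_finite_of_isOpen S₁ hS₁open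
  haveI : S₁.FiniteIndex := Subgroup.finiteIndex_of_finite_quotient
  exact hcore L inferInstance hKL hLE hLfi hLst' S₁ inferInstance fun a ha => ha

end GaloisLevelData

end ProfiniteSemiGraph

end Literature.AnabelianGeometry.SemiGraphs
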